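import Literature.Probability.Percolation.SlabRSWSnapMirror
import HarnessLib

/-!
# Newman–Tassion–Wu 2017, Lemma 3.16 / `(H316)` reduced to local gadgets on the coarse-grained domain

Topic: `Literature/Probability/Percolation`. Assembly of the Case-3 chain for the COARSE-GRAINED gluing
datum `Q₂ = snapGlue k n hn Γ` (`SlabRSWSnapDatum/SnapConnector/SnapMirror.lean`): separation
(`real_evOff_explored_le_toSnap`, radius `60`), crossing (`mem_evNear_snapGlue`) + Harris–FKG with the
mirror symmetry (here: `real_sq_le_snapGlue`), the abstract linear gluing bound of the tree
(`GlueData.real_evAB_inter_evNear_le_of_gadgets`), and the identification of the glued event with a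
left–right crossing (here: `real_evCA_snapGlue_le`) — the exact analogue of `h316_of_gadgets`
(`SlabRSWLemma316.lean`, datum `mirrorGlue`) with the gadget supply now asked on `Q₂`, whose domain
`R' ∖ N(Γ)` is rectilinear at mesh `40` (NTW's `K_□`, "regular enough to apply Theorem 3.6", Remark 2
after Theorem 3.7):

* `real_sq_le_snapGlue` — `P[Q₂.evAB]² ≤ P[Q₂.evAB ∩ Q₂.evNear ρ]`; `real_evCA_snapGlue_le` —
  `P[Q₂.evCA] ≤ f(14n, 13n)`;

* **`h316_of_snapGadgets'`** — `(H316)` at `ρ₂ = 60` (the hypothesis of `thm314_hCase3_of`, hence of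
  NTW's Theorem 3.1 at `p_c` via `NewmanTassionWu2017_thm31_of_h316`) from a supply of local
  modifications `GadgetSpec Q₂ k r ω' ω''` for every admissible `ω` (lattice, `A ⟷^{S'} B`,
  `𝖡 ⟷^{R'} C`, not `C ⟷^{R'} A`, not `C̄ ⟷^{R̄'} 𝒩(Γ̄, 60)`) and every lattice `ω' ∈ Q₂.evXn ρ`,
  with `y(x) = x²/(1 + λ^s)`, `s = 3(5k+4)(4r+1)²`;
* `h316_of_snapGadgets` — the same with the supply asked for every lattice `ω` with `A ⟷^{S'} B` only;
  `h316_of_snapGadgets_box` — the supply asked for `snapGlue k n hn Γ` and every vertex list `Γ` with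
  cells in `S' = [0,7n]×[0,8n-1]`.

## Sources

* C. M. Newman, V. Tassion, W. Wu, *Critical percolation and the minimal spanning tree in slabs*,
  Comm. Pure Appl. Math. 70 (2017), arXiv:1512.09107: §3.5, Lemma 3.16 and the proof of Theorem 3.14,
  Case 3 ((3.49)–(3.52)); Theorem 3.6 and Remark 2 after Theorem 3.7 [NewmanTassionWu2017].
-/

noncomputable section

namespace Literature.Probability.Percolation

open MeasureTheory LatticeModels SimpleGraph

namespace NTW17

variable {k : ℕ}

/-! ## Harris–FKG with the mirror symmetry; the glued event -/

section Harris

variable {n : ℕ} (hn : 1 ≤ n) {ω : BondConfig (slab 3 k)}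

/-- **Harris–FKG and `τ`-symmetry for the coarse datum** (proof of Lemma 3.16): with
`Q₂ = snapGlue k n hn Γ`, `Γ = Q.γ ω` for an admissible lattice `ω`,
`P[Q₂.evAB]² ≤ P[Q₂.evAB ∩ Q₂.evNear ρ]` for every `ρ`.
[cite: NewmanTassionWu2017, §3.5 (proof of Lemma 3.16: the symmetric pair of events and Theorem 3.6; Harris–FKG)] -/
theorem real_sq_le_snapGlue (hω : ω ⊆ (slabGraph 3 k).edgeSet) (hA : ω ∈ (case2Setup n hn).Q.evAB k)
    (p : unitInterval) (ρ : ℕ) :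
    (bondPercolation (slabGraph 3 k) p).real ((snapGlue k n hn ((case2Setup n hn).Q.γ k ω)).evAB k) ^ 2 ≤
      (bondPercolation (slabGraph 3 k) p).real
        ((snapGlue k n hn ((case2Setup n hn).Q.γ k ω)).evAB k ∩
          (snapGlue k n hn ((case2Setup n hn).Q.γ k ω)).evNear k ρ) := by
  set Q₂ := snapGlue k n hn ((case2Setup n hn).Q.γ k ω) with hQ₂
  set τ := planarReflect (14 * (n : ℤ)) with hτ
  set P := bondPercolation (slabGraph 3 k) p with hP
  set E₂ := slabConn k (τ '' Q₂.S) (τ '' Q₂.A) (τ '' Q₂.B) with hE₂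
  have hE₁ : Q₂.evAB k = slabConn k Q₂.S Q₂.A Q₂.B := rfl
  have hsymm : P.real E₂ = P.real (Q₂.evAB k) := by
    rw [hE₁, hE₂]
    exact real_slabConn_image k τ (planarAdj_planarReflect _) p _ _ _
  have hfin : Q₂.S.Finite := Q₂.hSfin
  have hH : P.real (Q₂.evAB k) * P.real E₂ ≤ P.real (Q₂.evAB k ∩ E₂) := by
    rw [hE₁, hE₂]
    exact harris_fkg_local (slabGraph 3 k) p (isUpperSet_openCrossing _ _ _) (isUpperSet_openCrossing _ _ _)
      (isLocalEvent_slabConn hfin _ _) (isLocalEvent_slabConn (hfin.image _) _ _)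
  have hae : ∀ᵐ ω' ∂P, ω' ∈ Q₂.evAB k ∩ E₂ → ω' ∈ Q₂.evAB k ∩ Q₂.evNear k ρ := by
    filter_upwards [ae_subset_edgeSet (slabGraph 3 k) p] with ω' hω'
    rintro ⟨h1, h2⟩
    exact ⟨h1, Q₂.evNear_mono (Nat.zero_le ρ) (mem_evNear_snapGlue hn hω hA hω' h1 h2)⟩
  have hmono : P.real (Q₂.evAB k ∩ E₂) ≤ P.real (Q₂.evAB k ∩ Q₂.evNear k ρ) := by
    simp only [measureReal_def]
    exact ENNReal.toReal_mono (measure_ne_top _ _) (measure_mono_ae hae)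
  calc P.real (Q₂.evAB k) ^ 2 = P.real (Q₂.evAB k) * P.real E₂ := by rw [sq, hsymm]
    _ ≤ _ := hH.trans hmono

/-- **The glued event of the coarse datum is a left–right crossing**: `P[Q₂.evCA] ≤ f(14n, 13n)`
(`Q₂` has the same `R`, `C`, `A` as `mirrorGlue`). [cite: NewmanTassionWu2017, §3.5 (proof of Lemma 3.16, (3.44): Y ↔ Y′ inside R gives f(14n,13n))] -/
theorem real_evCA_snapGlue_le (Γ : List (slab 3 k)) (p : unitInterval) :
    (bondPercolation (slabGraph 3 k) p).real ((snapGlue k n hn Γ).evCA k) ≤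
      (bondPercolation (slabGraph 3 k) p).real
        (slabConn k (boxR 0 (14 * n) 0 (13 * n)) {z | z.1 = 0} {z | z.1 = 14 * n}) := by
  rw [snapGlue_evCA hn Γ 0]
  exact real_evCA_mirrorGlue_le hn Γ p

end Harris

/-! ## `(H316)` from gadgets -/

/-- **NTW 2017, Lemma 3.16 / `(H316)` from local gadgets on the coarse-grained domain, admissible
form.** Fix `k`, radii `ρ`, `r`, `0 < p < 1` and `n₀`. Suppose that for every `n ≥ n₀` (`n ≥ 1`), every
admissible lattice configuration `ω` of the reflected frame (`A ⟷^{S'} B`, `𝖡 ⟷^{R'} C`, not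
`C ⟷^{R'} A`, not `C̄ ⟷^{R̄'} 𝒩(Γ̄, 60)`; `Γ = Q.γ ω`) and every lattice configuration `ω'` of
`Q₂.evXn ρ` (`Q₂ = snapGlue k n hn Γ`) a local modification `GadgetSpec Q₂ k r ω' ω''` exists. Then
`(H316)` holds at `ρ₂ = 60` with `y = x²/(1 + λ^s)`, `λ = 2/min{p,1-p}`, `s = 3(5k+4)(4r+1)²`.
[cite: NewmanTassionWu2017, §3.5 (Lemma 3.16 and proof of Theorem 3.14, Case 3, (3.49)–(3.52))] -/
theorem h316_of_snapGadgets' {ρ r n₀ : ℕ} (p : unitInterval) (hp0 : 0 < (p : ℝ)) (hp1 : (p : ℝ) < 1)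
    (hgad : ∀ (n : ℕ) (hn : 1 ≤ n), n₀ ≤ n → ∀ ω : BondConfig (slab 3 k), ω ⊆ (slabGraph 3 k).edgeSet →
      ω ∈ (case2Setup n hn).Q.evAB k → ω ∈ slabConn k (case2Setup n hn).R {z | z.2 = 0} (case2Setup n hn).C →
      ω ∉ (case2Setup n hn).Q.evCA k → ω ∉ (case2Setup n hn).Q.evNear k 60 →
      ∀ ω' : BondConfig (slab 3 k), ω' ⊆ (slabGraph 3 k).edgeSet →
      ω' ∈ (snapGlue k n hn ((case2Setup n hn).Q.γ k ω)).evXn k ρ →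
      ∃ ω'', GadgetSpec (snapGlue k n hn ((case2Setup n hn).Q.γ k ω)) k r ω' ω'') :
    ∀ x : ℝ, 0 < x → ∃ y : ℝ, 0 < y ∧ ∃ n₃ : ℕ, ∀ n : ℕ, n₃ ≤ n → ∀ hn : 1 ≤ n,
      ∀ ω : BondConfig (slab 3 k), ω ⊆ (slabGraph 3 k).edgeSet →
      ω ∈ (case2Setup n hn).Q.evAB k → ω ∈ slabConn k (case2Setup n hn).R {z | z.2 = 0} (case2Setup n hn).C →
      ω ∉ (case2Setup n hn).Q.evCA k → ω ∉ (case2Setup n hn).Q.evNear k 60 →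
      x ≤ (bondPercolation (slabGraph 3 k) p).real
        ((case2Setup n hn).Q.evOff k {z | z.2 = 0} ((case2Setup n hn).Q.explored k 60 ω)) →
      y ≤ (bondPercolation (slabGraph 3 k) p).real
        (slabConn k (boxR 0 (14 * n) 0 (13 * n)) {z | z.1 = 0} {z | z.1 = 14 * n}) := by
  intro x hx
  set Λ : ℝ := 1 + (2 / min (p : ℝ) (1 - p)) ^ (3 * ((5 * k + 4) * (2 * (2 * r) + 1) ^ 2)) with hΛ
  have hΛpos : 0 < Λ := by positivity
  refine ⟨x ^ 2 / Λ, by positivity, max n₀ 1, fun n hn3 hn ω hω hAB hBC hCA hN hxoff => ?_⟩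
  have hn₀ : n₀ ≤ n := le_trans (le_max_left _ _) hn3
  set P := bondPercolation (slabGraph 3 k) p with hP
  set Q₂ := snapGlue k n hn ((case2Setup n hn).Q.γ k ω) with hQ₂
  -- separation: `x ≤ P[Q₂.evAB]`
  have h1 : x ≤ P.real (Q₂.evAB k) := hxoff.trans (real_evOff_explored_le_toSnap hn hω hAB p)
  -- crossing + Harris: `P[Q₂.evAB]² ≤ P[evAB ∩ evNear ρ]`
  have h2 := real_sq_le_snapGlue hn hω hAB p ρ
  -- gadgets: `P[evAB ∩ evNear ρ] ≤ Λ P[evCA]`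
  have h3 := real_evAB_inter_evNear_le_of_gadgets (Q := Q₂) (ρ := ρ) (r := r) p hp0 hp1
    (hgad n hn hn₀ ω hω hAB hBC hCA hN)
  -- the glued event is a crossing
  have h4 := real_evCA_snapGlue_le hn ((case2Setup n hn).Q.γ k ω) p
  rw [div_le_iff₀ hΛpos]
  calc x ^ 2 ≤ P.real (Q₂.evAB k) ^ 2 := pow_le_pow_left₀ hx.le h1 2
    _ ≤ _ := h2
    _ ≤ _ := h3
    _ ≤ Λ * _ := by rw [← hΛ]; exact mul_le_mul_of_nonneg_left h4 hΛpos.le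
    _ = _ := mul_comm _ _

/-- **NTW 2017, Lemma 3.16 / `(H316)` from local gadgets on the coarse-grained domain.** As
`h316_of_snapGadgets'`, with the gadget supply asked for every lattice `ω` with `A ⟷^{S'} B` (so that
`Γ = Q.γ ω` exists) and every lattice `ω' ∈ Q₂.evXn ρ`.
[cite: NewmanTassionWu2017, §3.5 (Lemma 3.16 and proof of Theorem 3.14, Case 3, (3.49)–(3.52))] -/
theorem h316_of_snapGadgets {ρ r n₀ : ℕ} (p : unitInterval) (hp0 : 0 < (p : ℝ)) (hp1 : (p : ℝ) < 1)
    (hgad : ∀ (n : ℕ) (hn : 1 ≤ n), n₀ ≤ n → ∀ ω : BondConfig (slab 3 k), ω ⊆ (slabGraph 3 k).edgeSet →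
      ω ∈ (case2Setup n hn).Q.evAB k → ∀ ω' : BondConfig (slab 3 k), ω' ⊆ (slabGraph 3 k).edgeSet →
      ω' ∈ (snapGlue k n hn ((case2Setup n hn).Q.γ k ω)).evXn k ρ →
      ∃ ω'', GadgetSpec (snapGlue k n hn ((case2Setup n hn).Q.γ k ω)) k r ω' ω'') :
    ∀ x : ℝ, 0 < x → ∃ y : ℝ, 0 < y ∧ ∃ n₃ : ℕ, ∀ n : ℕ, n₃ ≤ n → ∀ hn : 1 ≤ n,
      ∀ ω : BondConfig (slab 3 k), ω ⊆ (slabGraph 3 k).edgeSet →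
      ω ∈ (case2Setup n hn).Q.evAB k → ω ∈ slabConn k (case2Setup n hn).R {z | z.2 = 0} (case2Setup n hn).C →
      ω ∉ (case2Setup n hn).Q.evCA k → ω ∉ (case2Setup n hn).Q.evNear k 60 →
      x ≤ (bondPercolation (slabGraph 3 k) p).real
        ((case2Setup n hn).Q.evOff k {z | z.2 = 0} ((case2Setup n hn).Q.explored k 60 ω)) →
      y ≤ (bondPercolation (slabGraph 3 k) p).real
        (slabConn k (boxR 0 (14 * n) 0 (13 * n)) {z | z.1 = 0} {z | z.1 = 14 * n}) :=
  h316_of_snapGadgets' p hp0 hp1 fun n hn hn₀ ω hω hAB _ _ _ => hgad n hn hn₀ ω hω hAB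

/-- **`(H316)` from local gadgets for `snapGlue Γ` for every lattice path `Γ` inside `S'`** — the
path-quantified form of `h316_of_snapGadgets`: the supply is asked for `Q₂ = snapGlue k n hn Γ` and EVERY
list `Γ` of slab vertices whose cells lie in `S' = [0,7n]×[0,8n-1]` (as `Γ_min` does), instead of the
realised `Γ = Q.γ ω`. [cite: NewmanTassionWu2017, §3.5 (Lemma 3.16 and proof of Theorem 3.14, Case 3, (3.49)–(3.52))] -/
theorem h316_of_snapGadgets_box {ρ r n₀ : ℕ} (p : unitInterval) (hp0 : 0 < (p : ℝ)) (hp1 : (p : ℝ) < 1)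
    (hgad : ∀ (n : ℕ) (hn : 1 ≤ n), n₀ ≤ n → ∀ Γ : List (slab 3 k),
      (∀ g ∈ Γ, planar k g ∈ boxR 0 (7 * n) 0 (8 * n - 1)) →
      ∀ ω' : BondConfig (slab 3 k), ω' ⊆ (slabGraph 3 k).edgeSet →
      ω' ∈ (snapGlue k n hn Γ).evXn k ρ → ∃ ω'', GadgetSpec (snapGlue k n hn Γ) k r ω' ω'') :
    ∀ x : ℝ, 0 < x → ∃ y : ℝ, 0 < y ∧ ∃ n₃ : ℕ, ∀ n : ℕ, n₃ ≤ n → ∀ hn : 1 ≤ n,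
      ∀ ω : BondConfig (slab 3 k), ω ⊆ (slabGraph 3 k).edgeSet →
      ω ∈ (case2Setup n hn).Q.evAB k → ω ∈ slabConn k (case2Setup n hn).R {z | z.2 = 0} (case2Setup n hn).C →
      ω ∉ (case2Setup n hn).Q.evCA k → ω ∉ (case2Setup n hn).Q.evNear k 60 →
      x ≤ (bondPercolation (slabGraph 3 k) p).real
        ((case2Setup n hn).Q.evOff k {z | z.2 = 0} ((case2Setup n hn).Q.explored k 60 ω)) →
      y ≤ (bondPercolation (slabGraph 3 k) p).real
        (slabConn k (boxR 0 (14 * n) 0 (13 * n)) {z | z.1 = 0} {z | z.1 = 14 * n}) :=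
  h316_of_snapGadgets p hp0 hp1 fun n hn hn₀ _ _ hAB =>
    hgad n hn hn₀ _ fun g hg => ((case2Setup n hn).Q.γ_spec hAB).1.subset g hg

end NTW17

end Literature.Probability.Percolation
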